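import Summits.Ventures.CertifiedArithmetic.LowPrec.SRPythagorasLiabilityCases
import HarnessLib

/-!
# CXXIII — The liability potential (IV): the fine/top case, the Pythagorean law on TWO-RUN windows of
# unbounded jump for EVERY number `N ≥ 1` of random bits, and a kernel witness that the level budget
# fails where the law holds

HONEST FRAMING: certified error envelopes and provably optimal rounding/accumulation schemes for
low-precision formats under stated cost models; every table by two implementations; no hardware or
vendor claims.

Fourth file of the liability series (CXX accounting theorem; CXXI two-run windows; CXXII five cases of
the two-point inequality).  PROVED (exact, no `sorry`):
* §1 `pairLE_fine_top` — a non-representable point `c` of the fine run against a point `c'` of the top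
  run (the "misalignment pre-paid" step): by `dyadic_split` either `E ∣ f` (all children
  `E`-congruent to the top lattice, pure cost domination) or `f < E` (the liability created by the fine
  rounding exceeds the available cost domination by at most `y(c)·(3E/2) ≤ 3E²/8`, because
  `y(c) ≤ f/2 ≤ E/4`; the two bias budgets `E(E − y)` pay); `pairLE_of_twoRun` — the two-point
  inequality for ANY two window points at a fine-lattice separation (or equal), every `N ≥ 1`, fine
  run at most `2^N` top cells long.
* §2 `TwoRunWindow.acc_sq_add_liab_le_twoRun`, `TwoRunWindow.acc_sq_le_twoRun` — THE PYTHAGOREAN LAW ON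
  TWO-RUN WINDOWS: for `hW : TwoRunWindow F lo mid hi g i J`, `0 ≤ lo`, `1 ≤ N`, `mid − lo ≤ 2^N·2^J·g`,
  every no-saturation tree inside the window satisfies
  `E(ŝₙ − sₙ)² ≤ n·(2^J g)²/4 + (n·2^{−N}·2^J g)²` (states of a positive level are window points,
  CXXI `reach_mem_window`, hence pairwise at lattice separations; truncations in `[0, E]` by CXIV
  `cellA`).  NEW CONTENT: `3 ≤ N` with an UNBOUNDED jump `2^{J−i}`, the regime in which no time-local
  certificate of the programme exists.
* §3 `F38_xLB_levelLE_fails_law_holds` (kernel, `decide`): the two-run window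
  `F38 = {0,…,32} ∪ {160, 288, …, 672}` (`f = 1`, `G = 128`, jump `128`, `mid − lo = 32 ≤ 2^3·G`),
  `N = 3`, `ŝ₀ = 160`, summands `xLB`, `n = 4`: a no-saturation tree in the window on which CXVII's
  level budget `LevelLE` is FALSE (`L₂ = 345239/64 > G²/4 + 5E² = 5376`: the cost of level 2 was
  pre-paid at level 1 as a covariance gain) while `E(ŝ₄ − s₄)² = 3219993/256 ≈ 0.614·20480` as §2
  predicts — the first kernel-certified failure of the level budget at `N = 3`.

TWO IMPLEMENTATIONS.  The witness and the case analysis were found / stress-tested by the reference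
tree enumerator (A: exhaustive two-point checks on two-run windows, `N = 1, 2, 3`; random tree hunts)
and re-evaluated by an independent literal transcription of the Lean definitions (B: `levelQ … 2`,
`E(ŝ₄ − s₄)²`, `NoSat`, `InWindow` agree); the kernel decided the stated equalities.  Scripts: the
cell's `code/sr/gen23/`; no cluster compute.

SCOPE — NOT CLAIMED.  (1) CXV's question for general nested windows (three or more distinct widths) at
`3 ≤ N < J` stays OPEN: there the two-point inequality is FALSE (A: widths `1…16`, `N = 2`, the pair
`c = 6` exact / `c' = 62` in the `G/2` cell at a zero-truncation level owes `224` against a budget of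
`148` — an intermediate cell resets the phase for free), although the law held in every tree hunted
(max ratio `0.9957`, format windows up to `(m, J) = (3, 6)`, `n ≤ 7`, `N = 3`); a potential over three
or more scales is the open next step.  (2) The length hypothesis is used (fine/fine) and the two-point
inequality fails without it (A: a fine run of `64` cells, `N = 2`, `G = 8`).  (3) Inside a binary
format two consecutive runs are two binades (jump `2`, CXVI's class); the large-jump two-run class is a
synthetic stress class — exactly the class on which every earlier certificate fails (§3).  References:
[ConnollyHighamMary2021], [ElararEtAl2025], [FitzgibbonFelix2025], IEEE P3109 interim report.
-/

namespace Summit.Ventures.CertifiedArithmetic.LowPrec.SR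

open Literature.ComputerArithmetic.ConnollyHighamMary2021
open Finset

variable {K : Type*} [Field K] [LinearOrder K] [IsStrictOrderedRing K] [FloorRing K]

namespace LimitedBits

namespace TwoRunWindow

variable {F : Finset K} {lo mid hi g : K} {i J : ℕ}

/-! ### 1. The fine/top case and the two-point inequality for all pairs -/

section Cases

variable (hW : TwoRunWindow F lo mid hi g i J) (hlo : 0 ≤ lo) (N : ℕ)
include hW hlo

set_option maxHeartbeats 1600000 in
/-- A non-representable point of the fine run against a point of the top run. -/
theorem pairLE_fine_top (hN : 1 ≤ N) {c c' : K} (hc1 : lo ≤ c) (hcm : c < mid)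
    (hne : up F c ≠ dn F c) (hc1' : mid ≤ c') (hc2' : c' ≤ hi) :
    PairLE F (probAwayA N) (2 ^ J * g) (2 ^ J * g / 2 ^ N) c c' := by
  have hq01 : ∀ θ : K, 0 ≤ θ → θ ≤ 1 → 0 ≤ probAwayA N θ ∧ probAwayA N θ ≤ 1 :=
    fun θ h0 h1 => probAwayA_mem N θ h0 h1
  have hg := hW.nested.pos
  have hE : (0 : K) < 2 ^ J * g / 2 ^ N := by positivity
  have hGE : (2 : K) ^ J * g = 2 ^ N * (2 ^ J * g / 2 ^ N) := by field_simp
  have hf : (0 : K) < 2 ^ i * g := by positivity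
  have h2N : (2 : K) ≤ 2 ^ N :=
    calc (2 : K) = 2 ^ 1 := by norm_num
      _ ≤ 2 ^ N := pow_le_pow_right₀ (by norm_num) hN
  obtain ⟨hw, hy, hum, hlod, ⟨zd, hzd⟩, hdlt, hult, hπ⟩ := hW.fineData hlo N hc1 hcm hne
  obtain ⟨⟨z', hz'⟩, hwc', hy', hmd', hdc', hcu', huh'⟩ := hW.topData hlo N hc1' hc2'
  obtain ⟨zm, hzm⟩ := hW.fgrid mid hW.mid_mem hW.lo_le_mid hW.mid_le_hi
  have hcc : c < c' := lt_of_lt_of_le hcm hc1'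
  have hu : up F c = dn F c + 2 ^ i * g := by linarith
  have hud' : dn F c + 2 ^ i * g ≤ dn F c' := by linarith
  have hdd' : dn F c ≤ dn F c' := by linarith
  -- liabilities of a point `a ≤ ⌊c̄'⌋` against the two candidates of `c'`
  have hres : ∀ a, a ≤ dn F c' →
      pairLiab (2 ^ J * g / 2 ^ N) a (up F c')
          = (up F c' - a) * resid (a - dn F c') (2 ^ J * g / 2 ^ N) ∧
        pairLiab (2 ^ J * g / 2 ^ N) a (dn F c')
          = (dn F c' - a) * resid (a - dn F c') (2 ^ J * g / 2 ^ N) := by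
    intro a ha
    have hr : resid (a - up F c') (2 ^ J * g / 2 ^ N) = resid (a - dn F c') (2 ^ J * g / 2 ^ N) := by
      rcases hwc' with h | h
      · rw [h]
      · rw [h, show a - (dn F c' + 2 ^ J * g) = (a - dn F c') + ((-(2 ^ N) : ℤ) : K)
          * (2 ^ J * g / 2 ^ N) by push_cast; linear_combination (-1 : K) * hGE, resid_add_mul hE]
    constructor
    · unfold pairLiab; rw [abs_of_nonpos (by linarith [dn_le_up F c']), neg_neg, hr]; ring
    · unfold pairLiab; rw [abs_of_nonpos (by linarith), neg_neg]; ring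
  -- the pair step: `π·(m' − ⌈c̄⌉)·ψ₁ + (1 − π)·(m' − ⌊c̄⌋)·ψ₀`
  have h0 : pairStepQ F (probAwayA N) (2 ^ J * g / 2 ^ N) c c'
      = pUpQ F (probAwayA N) c
          * ((pUpQ F (probAwayA N) c' * up F c' + (1 - pUpQ F (probAwayA N) c') * dn F c'
              - (dn F c + 2 ^ i * g)) * resid (dn F c + 2 ^ i * g - dn F c') (2 ^ J * g / 2 ^ N))
        + (1 - pUpQ F (probAwayA N) c)
          * ((pUpQ F (probAwayA N) c' * up F c' + (1 - pUpQ F (probAwayA N) c') * dn F c'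
              - dn F c) * resid (dn F c - dn F c') (2 ^ J * g / 2 ^ N)) := by
    simp only [pairStepQ, stepQ]
    rw [hu, (hres _ hud').1, (hres _ hud').2, (hres _ hdd').1, (hres _ hdd').2]; ring
  have hm' : pUpQ F (probAwayA N) c' * up F c' + (1 - pUpQ F (probAwayA N) c') * dn F c'
      = c' - truncQ F (probAwayA N) c' := by
    unfold truncQ stepQ; ring
  obtain ⟨hp0, hp1⟩ := pUpQ_mem F hq01 c
  obtain ⟨hp0', hp1'⟩ := pUpQ_mem F hq01 c'
  have hMge : dn F c + 2 ^ i * g ≤ c' - truncQ F (probAwayA N) c' := by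
    rw [← hm']
    have := mul_nonneg hp0' (sub_nonneg.mpr (hdc'.trans hcu'))
    linarith
  -- truncation bounds and variance slacks
  have huf : (0 : K) < 2 ^ i * g / 2 ^ N := by positivity
  have hyb := resid_nonneg_lt (y := c - dn F c) huf
  rw [← hy] at hyb
  have hyb' := resid_nonneg_lt (y := c' - dn F c') hE
  rw [← hy'] at hyb'
  have hfG : (2 : K) ^ i * g ≤ 2 ^ J * g :=
    mul_le_mul_of_nonneg_right (pow_le_pow_right₀ (by norm_num) hW.i_le) hg.le
  have hufE : (2 : K) ^ i * g / 2 ^ N ≤ 2 ^ J * g / 2 ^ N :=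
    div_le_div_of_nonneg_right hfG (by positivity)
  have hwG' : up F c' - dn F c' ≤ 2 ^ J * g := by
    rcases hwc' with h | h
    · rw [h, sub_self]; positivity
    · rw [h]; linarith
  have hV := vslackQ_nonneg F hq01 (c := c) (G := 2 ^ J * g) (sub_nonneg.mpr (dn_le_up F c))
    (by rw [hw]; exact hfG)
  have hV' := vslackQ_nonneg F hq01 (sub_nonneg.mpr (dn_le_up F c')) hwG'
  -- cost domination against `⌊c̄'⌋`
  have hcd := costdom (D := dn F c') hE hcc.le (truncQ F (probAwayA N) c)
  rw [← hy'] at hcd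
  have hj : dn F c - dn F c' = resid (dn F c - dn F c') (2 ^ J * g / 2 ^ N)
      + (⌊(dn F c - dn F c') / (2 ^ J * g / 2 ^ N)⌋ : ℤ) * (2 ^ J * g / 2 ^ N) := by
    unfold resid; ring
  have hr0 := resid_nonneg_lt (y := dn F c - dn F c') hE
  rcases dyadic_split hg i J N with ⟨d, hd⟩ | ⟨m, hm, hfE⟩
  · -- (i) `f` is a multiple of `E`: both residues vanish and `y ≤ φ`
    have hdd : dn F c - dn F c' = (((zd - zm) * 2 ^ d - z' * 2 ^ N : ℤ) : K) * (2 ^ J * g / 2 ^ N) := by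
      push_cast
      linear_combination hzd - hzm - hz' + ((zd : K) - zm) * hd + (-(z' : K)) * hGE
    have hψ0 : resid (dn F c - dn F c') (2 ^ J * g / 2 ^ N) = 0 := by rw [hdd, resid_int_mul hE]
    have hψ1 : resid (dn F c + 2 ^ i * g - dn F c') (2 ^ J * g / 2 ^ N) = 0 := by
      have hdd' := hdd
      push_cast at hdd'
      rw [show dn F c + 2 ^ i * g - dn F c'
          = (((zd - zm) * 2 ^ d - z' * 2 ^ N + 2 ^ d : ℤ) : K) * (2 ^ J * g / 2 ^ N) by
            push_cast; linear_combination hdd' + hd, resid_int_mul hE]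
    have hφ : resid (c - dn F c') (2 ^ J * g / 2 ^ N) = resid (c - dn F c) (2 ^ J * g / 2 ^ N) := by
      rw [show c - dn F c' = (c - dn F c) + (((zd - zm) * 2 ^ d - z' * 2 ^ N : ℤ) : K)
          * (2 ^ J * g / 2 ^ N) by linear_combination hdd, resid_add_mul hE]
    have hdN : d ≤ N := by
      by_contra h; push Not at h
      have h1 : (2 : K) ^ N < 2 ^ d := pow_lt_pow_right₀ (by norm_num) h
      have h2 := mul_lt_mul_of_pos_right h1 hE
      linarith
    obtain ⟨e, he⟩ : ∃ e, N = d + e := ⟨N - d, by omega⟩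
    have h2 : (2 : K) ^ N = 2 ^ d * 2 ^ e := by rw [he, pow_add]
    have hEu : ((2 ^ e : ℕ) : K) * (2 ^ i * g / 2 ^ N) = 2 ^ J * g / 2 ^ N := by
      push_cast; rw [hd, h2]; field_simp
    have hyφ : truncQ F (probAwayA N) c ≤ resid (c - dn F c') (2 ^ J * g / 2 ^ N) := by
      rw [hφ, hy, ← hEu]
      exact resid_le_resid_mul huf (by positivity)
    have hΔφ := mul_nonneg (sub_nonneg.mpr hcc.le) (sub_nonneg.mpr hyφ)
    have P8 := mul_nonneg hE.le (show 0 ≤ 2 ^ J * g / 2 ^ N - truncQ F (probAwayA N) c by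
      linarith only [hyb.2, hufE])
    have P6 := mul_nonneg hE.le (sub_nonneg.mpr hyb'.2.le)
    unfold PairLE
    rw [h0, hψ0, hψ1]
    linarith only [hcd, hΔφ, hV, hV', P8, P6]
  · -- (ii) `E = 2^m·f` with `f < E`
    have hm0 : 1 ≤ m := by
      rcases Nat.eq_zero_or_pos m with h | h
      · rw [h, pow_zero, one_mul] at hm; linarith
      · exact h
    have hfE2 : 2 * (2 ^ i * g) ≤ 2 ^ J * g / 2 ^ N := by
      rw [hm]
      have : (2 : K) ≤ 2 ^ m :=
        calc (2 : K) = 2 ^ 1 := by norm_num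
          _ ≤ 2 ^ m := pow_le_pow_right₀ (by norm_num) hm0
      exact mul_le_mul_of_nonneg_right this hf.le
    have hGf : (2 : K) ^ J * g = 2 ^ (N + m) * (2 ^ i * g) := by
      rw [pow_add, mul_assoc, ← hm]; exact hGE
    have hdd : dn F c - dn F c' = ((zd - zm - z' * 2 ^ (N + m) : ℤ) : K) * (2 ^ i * g) := by
      push_cast; linear_combination hzd - hzm - hz' + (-(z' : K)) * hGf
    obtain ⟨k, hk0, hkM, hk⟩ :=
      resid_mul_eq_int hf (2 ^ m) (by positivity) (zd - zm - z' * 2 ^ (N + m))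
    have hψ0 : resid (dn F c - dn F c') (2 ^ J * g / 2 ^ N) = (k : K) * (2 ^ i * g) := by
      rw [hdd, hm]; push_cast at hk ⊢; exact hk
    have hk1 : (k : K) + 1 ≤ 2 ^ m := by
      have : k + 1 ≤ ((2 ^ m : ℕ) : ℤ) := by omega
      exact_mod_cast this
    have hψ0le : resid (dn F c - dn F c') (2 ^ J * g / 2 ^ N) ≤ 2 ^ J * g / 2 ^ N - 2 ^ i * g := by
      rw [hψ0, hm]
      have := mul_le_mul_of_nonneg_right hk1 hf.le
      linarith only [this]
    -- `φ = o + ψ₀` and `ψ₁ ≤ f + ψ₀`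
    have hφ : resid (c - dn F c') (2 ^ J * g / 2 ^ N)
        = (c - dn F c) + resid (dn F c - dn F c') (2 ^ J * g / 2 ^ N) := by
      rw [show c - dn F c' = ((c - dn F c) + resid (dn F c - dn F c') (2 ^ J * g / 2 ^ N))
          + (⌊(dn F c - dn F c') / (2 ^ J * g / 2 ^ N)⌋ : ℤ) * (2 ^ J * g / 2 ^ N) by
            linear_combination hj, resid_add_mul hE]
      exact resid_eq_self hE (by linarith only [hr0.1, hdlt]) (by linarith only [hult, hu, hψ0le])
    have hψ1 : resid (dn F c + 2 ^ i * g - dn F c') (2 ^ J * g / 2 ^ N)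
        ≤ 2 ^ i * g + resid (dn F c - dn F c') (2 ^ J * g / 2 ^ N) := by
      rw [show dn F c + 2 ^ i * g - dn F c'
          = (2 ^ i * g + resid (dn F c - dn F c') (2 ^ J * g / 2 ^ N))
            + (⌊(dn F c - dn F c') / (2 ^ J * g / 2 ^ N)⌋ : ℤ) * (2 ^ J * g / 2 ^ N) by
            linear_combination hj, resid_add_mul hE]
      exact resid_le_self hE (by linarith only [hr0.1, hf])
    -- `y = o − π·f`, `y ≤ f/2`, `π·f ≤ f`
    have hyo : truncQ F (probAwayA N) c = (c - dn F c) - pUpQ F (probAwayA N) c * (2 ^ i * g) := by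
      unfold truncQ stepQ; rw [hu]; ring
    have hyhalf : truncQ F (probAwayA N) c ≤ 2 ^ i * g / 2 := by
      have : (2 : K) ^ i * g / 2 ^ N ≤ 2 ^ i * g / 2 := div_le_div_of_nonneg_left hf.le (by norm_num) h2N
      linarith only [hyb.2, this]
    have hπf : pUpQ F (probAwayA N) c * (2 ^ i * g) ≤ 2 ^ i * g := mul_le_of_le_one_left hf.le hp1
    have hpq0 : 0 ≤ pUpQ F (probAwayA N) c * (1 - pUpQ F (probAwayA N) c) :=
      mul_nonneg hp0 (by linarith only [hp1])
    have hVc : vslackQ F (probAwayA N) (2 ^ J * g) c = (2 ^ J * g) ^ 2 / 4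
        - pUpQ F (probAwayA N) c * (1 - pUpQ F (probAwayA N) c) * (2 ^ i * g) ^ 2 := by
      unfold vslackQ; rw [hw]
    -- product facts for the final linear arithmetic (with `y` rewritten as `o − π·f`)
    have hS0 : 0 ≤ resid (dn F c - dn F c') (2 ^ J * g / 2 ^ N)
        + pUpQ F (probAwayA N) c * (2 ^ i * g) + 2 ^ J * g / 2 ^ N / 2 := by
      have := mul_nonneg hp0 hf.le
      linarith only [hr0.1, this, hE]
    have hS1 : resid (dn F c - dn F c') (2 ^ J * g / 2 ^ N)
        + pUpQ F (probAwayA N) c * (2 ^ i * g) + 2 ^ J * g / 2 ^ N / 2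
        ≤ 2 ^ J * g / 2 ^ N + 2 ^ J * g / 2 ^ N / 2 := by linarith only [hψ0le, hπf]
    rw [hyo] at hyhalf hyb
    have P1 := mul_le_mul_of_nonneg_left hψ1
      (mul_nonneg hp0 (sub_nonneg.mpr hMge))
    have P2 := mul_le_mul_of_nonneg_right hyhalf hS0
    have P3 := mul_le_mul_of_nonneg_left hS1 (show (0 : K) ≤ 2 ^ i * g / 2 by positivity)
    have P4 := mul_le_mul_of_nonneg_right hfE2 hE.le
    have P5 := mul_nonneg hyb'.1 (add_nonneg hr0.1 (mul_nonneg hp0 hf.le))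
    have P6 := mul_nonneg hE.le (sub_nonneg.mpr hyb'.2.le)
    have P7 := mul_nonneg hpq0 (sq_nonneg (2 ^ i * g))
    have P9 := sq_nonneg (2 ^ J * g)
    have P10 := sq_nonneg (2 ^ J * g / 2 ^ N)
    rw [hφ, hyo] at hcd
    unfold PairLE
    rw [h0, hm', hVc, hyo]
    linarith only [hcd, P1, P2, P3, P4, P5, P6, P7, P9, P10, hV']

/-- **The two-point inequality on a two-run window** (all `N ≥ 1`): for two points of the
window at a fine-lattice separation (or equal). -/
theorem pairLE_of_twoRun (hN : 1 ≤ N) (hlen : mid - lo ≤ 2 ^ N * (2 ^ J * g)) {c c' : K}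
    (hc1 : lo ≤ c) (hc2 : c ≤ hi) (hc1' : lo ≤ c') (hc2' : c' ≤ hi)
    (hsep : c = c' ∨ ∃ z : ℤ, c' - c = z * (2 ^ i * g)) :
    PairLE F (probAwayA N) (2 ^ J * g) (2 ^ J * g / 2 ^ N) c c' := by
  suffices key : ∀ a b : K, lo ≤ a → a ≤ hi → lo ≤ b → b ≤ hi → a < b →
      (∃ z : ℤ, b - a = z * (2 ^ i * g)) →
      PairLE F (probAwayA N) (2 ^ J * g) (2 ^ J * g / 2 ^ N) a b by
    rcases hsep with h | ⟨z, hz⟩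
    · subst h; exact hW.pairLE_self hlo N hN hc1 hc2
    · rcases lt_trichotomy c c' with h | h | h
      · exact key c c' hc1 hc2 hc1' hc2' h ⟨z, hz⟩
      · subst h; exact hW.pairLE_self hlo N hN hc1 hc2
      · exact (pairLE_comm F (probAwayA N) _ _ c' c).mp
          (key c' c hc1' hc2' hc1 hc2 h ⟨-z, by push_cast; linarith⟩)
  intro a b ha1 ha2 hb1 hb2 hab hz
  obtain ⟨z, hz⟩ := hz
  rcases le_or_gt mid b with hmb | hmb
  · rcases le_or_gt mid a with hma | hma
    · exact hW.pairLE_top_top hlo N hma ha2 hmb hb2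
    · by_cases he : up F a = dn F a
      · exact hW.pairLE_exact_top hlo N ha1 hab hmb hb2 he
      · exact hW.pairLE_fine_top hlo N hN ha1 hma he hmb hb2
  · have hma : a < mid := hab.trans hmb
    by_cases he : up F a = dn F a
    · by_cases he' : up F b = dn F b
      · exact hW.pairLE_exact_exact N ha1 ha2 hb1 hb2 he he'
      · exfalso
        obtain ⟨-, -, -, -, ⟨w, hw⟩⟩ := hW.exactData (probAwayA N) ha1 ha2 he
        exact he' (hW.exact_of_grid hlo hb1 hmb.le (z := w + z) (by push_cast; linarith))
    · by_cases he' : up F b = dn F b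
      · exfalso
        obtain ⟨-, -, -, -, ⟨w, hw⟩⟩ := hW.exactData (probAwayA N) hb1 hb2 he'
        exact he (hW.exact_of_grid hlo ha1 hma.le (z := w - z) (by push_cast; linarith))
      · exact hW.pairLE_fine_fine hlo N hlen ha1 hab hmb he he' hz

end Cases

/-! ### 2. The Pythagorean law on two-run windows, every `N ≥ 1` -/

/-- **The Pythagorean law with liability on a two-run window** (CXX, all `N ≥ 1`).  On a two-run
window whose fine run is at most `2^N` top cells long, every no-saturation accumulation tree inside
the window satisfies `E(ŝₙ − sₙ)² + Λₙ ≤ n·G²/4 + (n·E)²`, `G = 2^J·g`, `E = G/2^N`, where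
`Λₙ = liabQ … n ≥ 0` is the liability of the final state distribution. -/
theorem acc_sq_add_liab_le_twoRun (hW : TwoRunWindow F lo mid hi g i J) (hlo : 0 ≤ lo) {N : ℕ}
    (hN : 1 ≤ N) (hlen : mid - lo ≤ 2 ^ N * (2 ^ J * g)) (x : ℕ → K) (n : ℕ) (s : K)
    (hns : NoSat F x n s) (hw : InWindow F lo hi x n s) :
    accExpQ F (probAwayA N) x n (fun t => (t - (s + ∑ i ∈ range n, x i)) ^ 2) s
        + liabQ F (probAwayA N) (2 ^ J * g / 2 ^ N) x n s
      ≤ n * ((2 ^ J * g) ^ 2 / 4) + (n * (2 ^ J * g / 2 ^ N)) ^ 2 := by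
  have hq01 : ∀ θ : K, 0 ≤ θ → θ ≤ 1 → 0 ≤ probAwayA N θ ∧ probAwayA N θ ≤ 1 :=
    fun θ h0 h1 => probAwayA_mem N θ h0 h1
  have hg := hW.nested.pos
  have hE : (0 : K) < 2 ^ J * g / 2 ^ N := by positivity
  refine (acc_sq_add_liab_le F hq01 (2 ^ J * g) (2 ^ J * g / 2 ^ N) x s n ?_ ?_).1
  · -- the two-point inequality at every pair of level-`k` states
    intro k hk t t' ht ht'
    obtain ⟨-, h1, h2⟩ := reach_window F lo hi k x s n t ht hk hns hw
    obtain ⟨-, h1', h2'⟩ := reach_window F lo hi k x s n t' ht' hk hns hw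
    refine hW.pairLE_of_twoRun hlo N hN hlen h1 h2 h1' h2' ?_
    cases k with
    | zero =>
      simp only [Reach] at ht ht'
      exact Or.inl (by rw [ht, ht'])
    | succ k =>
      obtain ⟨htF, htl, hth⟩ := reach_mem_window hW.nested k x s n t ht hk.le hns hw
      obtain ⟨htF', htl', hth'⟩ := reach_mem_window hW.nested k x s n t' ht' hk.le hns hw
      obtain ⟨z, hz⟩ := hW.fgrid t htF htl hth
      obtain ⟨z', hz'⟩ := hW.fgrid t' htF' htl' hth'
      exact Or.inr ⟨z' - z, by push_cast; linarith⟩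
  · -- every truncation lies in `[0, E]`
    intro k hk t ht
    obtain ⟨hh, h1, h2⟩ := reach_window F lo hi k x s n t ht hk hns hw
    unfold truncQ
    refine ⟨hW.nested.trunc_nonneg hlo N h1 h2, ?_⟩
    by_cases he : up F (t + x k) = dn F (t + x k)
    · obtain ⟨-, -, -, -, hdc, hcu⟩ := hW.nested.cand h1 h2
      rw [trunc_eq_zero_of_exact F (probAwayA N) hdc hcu he]; exact hE.le
    · obtain ⟨j, hj, -, -, -, hlt⟩ := hW.nested.cellA hlo N h1 h2 he
      have : (2 : K) ^ j * g / 2 ^ N ≤ 2 ^ J * g / 2 ^ N :=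
        div_le_div_of_nonneg_right (mul_le_mul_of_nonneg_right
          (pow_le_pow_right₀ (by norm_num) hj) hg.le) (by positivity)
      linarith

/-- **The Pythagorean law on two-run windows, every number `N ≥ 1` of random bits** (CXX):
`E(ŝₙ − sₙ)² ≤ n·(2^J g)²/4 + (n·2^{−N}·2^J g)²` for every no-saturation tree inside a two-run
window whose fine run is at most `2^N` top cells long — in particular for `N ≥ 3` and an
UNBOUNDED jump `2^{J−i}`, the regime where every per-level budget fails
(`F38_xLB_levelLE_fails_law_holds`). -/
theorem acc_sq_le_twoRun (hW : TwoRunWindow F lo mid hi g i J) (hlo : 0 ≤ lo) {N : ℕ}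
    (hN : 1 ≤ N) (hlen : mid - lo ≤ 2 ^ N * (2 ^ J * g)) (x : ℕ → K) (n : ℕ) (s : K)
    (hns : NoSat F x n s) (hw : InWindow F lo hi x n s) :
    accExpQ F (probAwayA N) x n (fun t => (t - (s + ∑ i ∈ range n, x i)) ^ 2) s
      ≤ n * ((2 ^ J * g) ^ 2 / 4) + (n * (1 / 2 ^ N * (2 ^ J * g))) ^ 2 := by
  have hg := hW.nested.pos
  have hE : (0 : K) < 2 ^ J * g / 2 ^ N := by positivity
  have h := hW.acc_sq_add_liab_le_twoRun hlo hN hlen x n s hns hw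
  have hΛ : 0 ≤ liabQ F (probAwayA N) (2 ^ J * g / 2 ^ N) x n s :=
    liabQ_nonneg F (fun θ h0 h1 => probAwayA_mem N θ h0 h1) hE x n s
  rw [show (1 : K) / 2 ^ N * (2 ^ J * g) = 2 ^ J * g / 2 ^ N by ring]
  linarith

end TwoRunWindow

/-! ### 3. Kernel instance: the level budget fails where the liability law holds -/

/-- The witness format: the integers `0, 1, …, 32` (fine run, width `1 = 2^0`) followed by the top
run `160, 288, 416, 544, 672` of width `128 = 2^7` — a two-run window `[0, 672]` with `mid = 32`,
`g = 1`, `i = 0`, `J = 7` (jump factor `128`, far beyond CXVI's bounded-jump class). -/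
def F38 : Finset ℚ := ((Finset.range 33).image fun n : ℕ => (n : ℚ)) ∪ {160, 288, 416, 544, 672}

/-- The level-budget-breaking schedule from `ŝ₀ = 160` (reference enumerator, gen 23). -/
def xLB : ℕ → ℚ := seqL [511 / 8, -2063 / 16, 1671 / 8, 2047 / 8]

/-- **`LevelLE` fails at `N = 3` on a two-run window, and the law holds there** (kernel decision).
`F38`, StochasticA with `N = 3` bits (`G = 128`, `E = 16`), `ŝ₀ = 160`, summands `xLB`, `n = 4`: a
no-saturation tree inside the window `[0, 672]`; the level budget of CXVII FAILS (at level `k = 2`: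
`L₂ = 345239/64 ≈ 5394.4 > G²/4 + 5E² = 5376` — the covariance cost of level 2 was pre-paid at
level 1 as a covariance GAIN, `L₁ ≈ 37.7`), while `E(ŝ₄ − s₄)² = 3219993/256 ≈ 12578 ≤ 20480`, ratio
`0.614`.  Both facts were found/checked by the two reference implementations (tree enumerator A,
literal evaluator B) before the kernel decided them. -/
theorem F38_xLB_levelLE_fails_law_holds :
    NoSat F38 xLB 4 160 ∧ InWindow F38 0 672 xLB 4 160 ∧
    levelLEB F38 (probAwayA 3) 128 (1 / 2 ^ 3) xLB 4 160 = false ∧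
    levelQ F38 (probAwayA 3) xLB 2 160 = 345239 / 64 ∧
    accExpQ F38 (probAwayA 3) xLB 4 (fun t => (t - (160 + ∑ i ∈ range 4, xLB i)) ^ 2) 160
      = 3219993 / 256 ∧
    (3219993 : ℚ) / 256 ≤ 4 * ((128 : ℚ) ^ 2 / 4) + (4 * ((1 : ℚ) / 2 ^ 3 * 128)) ^ 2 := by
  refine ⟨by rw [← noSatB_iff]; decide +kernel, by rw [← inWindowB_iff]; decide +kernel,
    by decide +kernel, by decide +kernel, by decide +kernel, by norm_num⟩

end LimitedBits

end Summit.Ventures.CertifiedArithmetic.LowPrec.SR
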